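/-
Copyright (c) 2026 the pub-hodgecm-mathlib formalisation cell (harness21).  R90-TF SLAB, section S10 (Rogawski 1990, Ch. 13.5–13.8 comparison engine read at `v`),
section planner R90-C138-plan (g0) typing FILE C at HOME (director s1983 (2)); h413 = `stmt-HodgeConjecture-24833`, route `HCCMUnconditional`.
-/
import Summits.HodgeConjecture.HodgeConjecture.Theorems.K2E1St1383LetterOfPinned1383      -- ★ `PinnedEq1383Hyp`, `TwistedSideVanishesHyp`, `Pinned1383Letter`, `e1St1383Letter_of_pinned1383`
import Summits.HodgeConjecture.HodgeConjecture.Theorems.K2E1PinnedHFunctionalOfDiscreteSum    -- ★ `DiscreteClass`, `classTrace`, `mult`, `pinnedDiscreteSum` (+ the `G`-side twin)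
import HarnessLib

/-!
# R90-TF ∕ S10 — FILE C (lowest file of the section, L9 «defs down, payments up»): the R1 ZERO-TWISTED-SLICE adapters and the PINNED class-trace functionals
# (`Cruxes/H413/Lines/R90_S10_ZeroSliceDefsC.lean`; ns `Summit.HodgeConjecture.HodgeConjecture.R90.S10`; DEFINITIONS + PROVED bookkeeping ONLY — NO socket, NO `sorry`)

WHAT (SOCKET-PLAN-S10 v1.2 `R90/R90-C138-plan/g0/SOCKET-PLAN-S10.v1.2.md` cbd25c9174d63f92, audits S10#0–#2).  Print [Rogawski1990, §13.8 Prop. 13.8.3 (proof) p. 218 l. 20–21]: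
«the stable orbital integrals of `f_u = f_{1u} − f_{2u}` vanish and we can take `φ_u = 0`».  Hence on the frozen test vector the twisted side of (13.8.3) is IDENTICALLY ZERO
(ruling R1, R90 bus 2026-09-04T15:11:06Z; audit S10#1 15:15:09Z «reading (d) CORRECT»): with `trTw := 0`, ★ `TwistedSideVanishesHyp` holds by `rfl` and ★ `PinnedEq1383Hyp`
(`trTw φ = 2 · Σᶠ_i m_i · trG i φ − trH f^H`) is EQUIVALENT to the STABILISED IDENTITY AT THE E.V.P. `t₀ = t(ρ)`:
  `Σᶠ_i m_i · trG i φ = ½ · trH f^H`  on matched pairs  — print: `S Θ_G(f) := Θ_G(f) − ½ SΘ_H(f^H)` [§10.3 p. 157] VANISHES on `f` with one stably-null factor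
  [Thm. 10.3.1 (b) «`SΘ_G` is a stable distribution», p. 157], the e.v.p. expansions [Props. 13.6.1, 13.6.2 pp. 209–210], separation of eigenvalues [§13.7 ∕ Prop. 13.7.1 p. 213,
  Prop. 13.8.1 = ★ `Literature.NumberTheory.Automorphic.unitaryCharactersLinearIndependent_holds`] and [Lemma 13.6.3 (b)(c) p. 211] (only `ρ` yields `t₀` on the `H` side).
This file proves the two zero-slice adapters GENERICALLY in the functionals (`twistedSideVanishes_zero`, `pinnedEq1383_of_stabilisedAtEvp`, and the converse
`stabilisedAtEvp_of_pinnedEq1383_zero`), and DEFINES the pinned functionals of FILE B as GLOBAL class-trace sums in ★ currency (anti-costume C4, audit S10#0 (b)):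
`classTraceAt ν Φ cl i x := Tr (cl i)(Φ x)` (★ `DiscreteClass.classTrace`) and `weightedCutSum ν Φ d x := Σᶠ_j m(d j) · Tr (d j)(Φ x)` — never the local expressions
`ε_i · Tr (loc i)_v(φ)` ∕ `2 · Tr π_St(f^H)` (those are the CONCLUSIONS of ★ `FlathGHyp` ∕ `FlathHHyp`, paid in FILE A from ★ `flath_conjuncts_of_inputs_of_locSmooth`).
FILE B (`R90_S10_StabilisedEvpLayerB.lean`, imports this file) states the ONE analytic socket `sock_S10_stabilisedAtEvp` over the frozen datum; FILE A
(`R90_S10_SimpleTF1383A.lean`, imports B) constructs the datum and pays ★ `E1St1383Letter` through ★ `e1St1383Letter_of_pinned1383`.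
HONEST LABEL: definitions and `rfl`∕`ring`-level bookkeeping; closes no socket; HC_CM is proved only modulo the 7 printed citations (2 remaining named inputs:
hLiu418 = `stmt-HodgeConjecture-24832`, h413 = `stmt-HodgeConjecture-24833`) until rung 0 closes.
-/

set_option autoImplicit false
set_option linter.dupNamespace false

noncomputable section

namespace Summit.HodgeConjecture.HodgeConjecture.R90.S10

open MeasureTheory NumberField CompactlySupported
open Literature.NumberTheory.Rogawski1990 Literature.NumberTheory.Automorphic Literature.NumberTheory.Automorphic.UnitaryGroup
open Summit.HodgeConjecture.HodgeConjecture.Cruxes.H413.K2E1TraceFormulaBeta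
open Summit.HodgeConjecture.HodgeConjecture.Cruxes.H413.K2E1St1383LetterOfPinned (PinnedEq1383Hyp TwistedSideVanishesHyp)
open Summit.HodgeConjecture.HodgeConjecture.Cruxes.H413.K2E1SpectralTermsDiscreteHalf
open Summit.HodgeConjecture.HodgeConjecture.Cruxes.H413.K2E1PinnedGFunctionalOfDiscreteSum (pinnedDiscreteSum pinnedDiscreteSum_eq_finsum)

universe u

/-! ## §1 The stabilised identity at the e.v.p. (abstract functionals) and the R1 zero-slice adapters -/

section ZeroSlice

variable (L : Type) [Field L] [NumberField L] [IsCMField L] (v : Pl L)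

/-- **THE STABILISED IDENTITY AT THE E.V.P. `t₀` (abstract functionals)** — «`Σ_{ψ_G(t(π)) = t₀} m(π) Tr π(f) = ½ · Tr ρ(f^H)`» on matched pairs `(f^H, φ)` at `v`,
as an equation between the level-cut `G`-functionals `trG i` (weights `m i`) and the `H`-functional `trH`: the R1 zero-twisted-slice form of (13.8.3).
[cite: Rogawski1990, §13.8 display (13.8.3) p. 218; §10.3 Thm. 10.3.1 (b) p. 157; §13.7 display (3) p. 213] -/
def StabilisedAtEvpHyp {ι : Type} (m : ι → ℕ) (Match : (HLoc L v → ℂ) → (Gqs L v → ℂ) → Prop)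
    (trG : ι → (Gqs L v → ℂ) → ℂ) (trH : (HLoc L v → ℂ) → ℂ) : Prop :=
  ∀ (fH : HLoc L v → ℂ) (φ : Gqs L v → ℂ), Match fH φ → ∑ᶠ i, (m i : ℂ) * trG i φ = (1 / 2 : ℂ) * trH fH

/-- **R1: the twisted side vanishes identically** — with `trTw := 0` («we can take `φ_u = 0`»), ★ `TwistedSideVanishesHyp` holds by `rfl` for ANY matching relation.
[cite: Rogawski1990, §13.8 Prop. 13.8.3 (proof) p. 218] -/
theorem twistedSideVanishes_zero (Match : (HLoc L v → ℂ) → (Gqs L v → ℂ) → Prop) :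
    TwistedSideVanishesHyp L v Match (fun _ => 0) := fun _ _ _ => rfl

/-- **R1 adapter: the stabilised identity at `t₀` gives ★ `PinnedEq1383Hyp` on the zero twisted slice** (`0 = 2 · (½ · trH f^H) − trH f^H`).
[cite: Rogawski1990, §13.8 display (13.8.3) p. 218; §10.3 Thm. 10.3.1 (b) p. 157] -/
theorem pinnedEq1383_of_stabilisedAtEvp {ι : Type} (m : ι → ℕ) (Match : (HLoc L v → ℂ) → (Gqs L v → ℂ) → Prop)
    (trG : ι → (Gqs L v → ℂ) → ℂ) (trH : (HLoc L v → ℂ) → ℂ) (h : StabilisedAtEvpHyp L v m Match trG trH) :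
    PinnedEq1383Hyp L v m Match (fun _ => 0) trG trH := by
  intro fH φ hM
  show (0 : ℂ) = _
  rw [h fH φ hM]
  ring

/-- **Converse: on the zero twisted slice ★ `PinnedEq1383Hyp` IS the stabilised identity at `t₀`** (so the cut loses nothing). [cite: Rogawski1990, §13.8 display (13.8.3) p. 218] -/
theorem stabilisedAtEvp_of_pinnedEq1383_zero {ι : Type} (m : ι → ℕ) (Match : (HLoc L v → ℂ) → (Gqs L v → ℂ) → Prop)
    (trG : ι → (Gqs L v → ℂ) → ℂ) (trH : (HLoc L v → ℂ) → ℂ) (h : PinnedEq1383Hyp L v m Match (fun _ => 0) trG trH) :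
    StabilisedAtEvpHyp L v m Match trG trH := by
  intro fH φ hM
  have h0 : (0 : ℂ) = 2 * ∑ᶠ i, (m i : ℂ) * trG i φ - trH fH := h fH φ hM
  linear_combination (-1 / 2 : ℂ) * h0

/-- The two zero-slice conjuncts of ★ `Pinned1383Letter`'s `∃`-body at once. [cite: Rogawski1990, §13.8 Prop. 13.8.3 (proof) p. 218] -/
theorem pinnedEq1383_and_twistedSideVanishes_of_stabilisedAtEvp {ι : Type} (m : ι → ℕ) (Match : (HLoc L v → ℂ) → (Gqs L v → ℂ) → Prop)
    (trG : ι → (Gqs L v → ℂ) → ℂ) (trH : (HLoc L v → ℂ) → ℂ) (h : StabilisedAtEvpHyp L v m Match trG trH) :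
    PinnedEq1383Hyp L v m Match (fun _ => 0) trG trH ∧ TwistedSideVanishesHyp L v Match (fun _ => 0) :=
  ⟨pinnedEq1383_of_stabilisedAtEvp L v m Match trG trH h, twistedSideVanishes_zero L v Match⟩

end ZeroSlice

/-! ## §2 The pinned functionals as GLOBAL class-trace sums (★ `DiscreteClass.classTrace` currency; any adelic group datum — `G` or the `H`-datum) -/

section Pinned

variable {K : Type} [Field K] [NumberField K] {𝒢 : AdelicGroupData.{u} K} {μ : Measure 𝒢.automorphicQuotient} [𝒢.IsAutomorphicMeasure μ]
  [MeasurableSpace 𝒢.Adelic] [BorelSpace 𝒢.Adelic] (ν : Measure 𝒢.Adelic) [IsFiniteMeasureOnCompacts ν]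

/-- **`Tr (cl i)(Φ x)`** — the class trace of the `i`-th member of a family of discrete classes at the frozen test vector `Φ x` (freezing map `Φ`, ★ `pinnedDiscreteSum`'s
convention): the `G`-side functional `trG i` of (13.8.3) for the e.v.p.-fibre family `cl`. [cite: Rogawski1990, §13.8 display (13.8.3) p. 218; §13.6 (13.6.1) p. 208] -/
def classTraceAt {X : Type*} (Φ : X → C_c(𝒢.Adelic, ℂ)) {ι : Type*} (cl : ι → DiscreteClass 𝒢 μ) (i : ι) (x : X) : ℂ :=
  (cl i).classTrace ν (Φ x)

/-- **`Σᶠ_j m(d j) · Tr (d j)(Φ x)`** — the multiplicity-weighted class-trace sum over a family of discrete classes at the frozen vector: the `H`-side functional `trH`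
of (13.8.3) for the family `d` of members of the packet `ρ` (print: each `m = 1`, [Rogawski1990, Thm. 11.5.1 (c) p. 165]). [cite: Rogawski1990, §13.8 display (13.8.3) p. 218] -/
def weightedCutSum {X : Type*} (Φ : X → C_c(𝒢.Adelic, ℂ)) {ι : Type*} (d : ι → DiscreteClass 𝒢 μ) (x : X) : ℂ :=
  ∑ᶠ j, (((d j).mult).toNat : ℂ) * (d j).classTrace ν (Φ x)

/-- Unfolding `classTraceAt`. [cite: Rogawski1990, §13.6 (13.6.1) p. 208] -/
@[simp] theorem classTraceAt_apply {X : Type*} (Φ : X → C_c(𝒢.Adelic, ℂ)) {ι : Type*} (cl : ι → DiscreteClass 𝒢 μ) (i : ι) (x : X) :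
    classTraceAt ν Φ cl i x = (cl i).classTrace ν (Φ x) := rfl

/-- Unfolding `weightedCutSum`. [cite: Rogawski1990, §13.6 (13.6.1) p. 208] -/
theorem weightedCutSum_apply {X : Type*} (Φ : X → C_c(𝒢.Adelic, ℂ)) {ι : Type*} (d : ι → DiscreteClass 𝒢 μ) (x : X) :
    weightedCutSum ν Φ d x = ∑ᶠ j, (((d j).mult).toNat : ℂ) * (d j).classTrace ν (Φ x) := rfl

/-- `weightedCutSum` is the `m`-weighted sum of `classTraceAt`. [cite: Rogawski1990, §13.6 (13.6.1) p. 208] -/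
theorem weightedCutSum_eq_finsum_classTraceAt {X : Type*} (Φ : X → C_c(𝒢.Adelic, ℂ)) {ι : Type*} (d : ι → DiscreteClass 𝒢 μ) (x : X) :
    weightedCutSum ν Φ d x = ∑ᶠ j, (((d j).mult).toNat : ℂ) * classTraceAt ν Φ d j x := rfl

/-- **EXHAUSTIVE CUT = THE FULL DISCRETE SUM**: if every class off the (finite, injective) family contributes `0` at `Φ x`, the weighted cut sum is ★ `pinnedDiscreteSum`
(the discrete term (13.6.1) at the frozen vector) — E1's `hoff` convention, recorded so FILE A can pass between the two currencies.
[cite: Rogawski1990, §13.6 (13.6.1) p. 208; §13.8 p. 218] -/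
theorem weightedCutSum_eq_pinnedDiscreteSum {X : Type*} (Φ : X → C_c(𝒢.Adelic, ℂ)) (x : X) {ι : Type*} [Finite ι] (d : ι → DiscreteClass 𝒢 μ)
    (hd : Function.Injective d) (hoff : ∀ c : DiscreteClass 𝒢 μ, c ∉ Set.range d → ((c.mult).toNat : ℂ) * c.classTrace ν (Φ x) = 0) :
    weightedCutSum ν Φ d x = pinnedDiscreteSum 𝒢 μ ν Φ x := by
  rw [weightedCutSum_apply,
    pinnedDiscreteSum_eq_finsum ν Φ x d hd hoff (fun _ => (1 : ℤ)) (fun j => (d j).classTrace ν (Φ x)) (fun j => by simp)]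
  simp

end Pinned

end Summit.HodgeConjecture.HodgeConjecture.R90.S10

end
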